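import Mathlib
import HarnessLib
import HarnessLib.Audit
import Summits.CriticalPhenomena.Statement
import Summits.CriticalPhenomena.Ising3DConformalLimit.Theorems.HyperoctahedralRPExistsScaleCovariantLimitSplitGlue
import HarnessLib.Audit.Status.Attr

/-!
Route: UnitLightCone

DORMANT since 2026-08-29T19:32:41Z (census g0: costume|duplicate of route-CriticalPhenomena-HyperoctahedralRP; reader census-reader-36-g0) — unstaffed, not closed; items shared with open routes are served there. `ledger route dormant <id> --off` reactivates.

# Route UnitLightCone — unit-speed light cone in an axis and a diagonal frame forces a round
two-point limit

It suffices to show X_ULC := (US) ∧ (N) ∧ (C) ∧ (D) ∧ (E). (US) UNIT SPEED [new, rank 2]: for every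
normalised, non-degenerate,
translation-invariant, scale-covariant pointwise scaling limit S of the critical Ising correlators
on Z^3, the two-point kernel
K(x) = S 2 (0,x) admits Kallen-Lehmann representations K(t n + w) = int cos(k.w) e^(-omega |t|)
dmu_n(k,omega) in the axis frame
n = e3 and in the face-diagonal frame n = (e1+e2)/sqrt2 whose spectral measures give NO weight to
{omega < |k|} ("no spacelike
weight at speed one"). The route's engine (crux LightConeRoundness, rank 7, = model-blind support
lemma TwoPointLightConeRigidity + the shared kernel support; pen proof in this header) is the
theorem: such unit cones in these two frames + O_h + homogeneity of degree -2Delta (0 < Delta < 2)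
force K to be O(3)-INVARIANT. (N) [rank 3] two-point isotropy upgrades to all n. (C) existence of a
scale-covariant translation-invariant limit, (D) the normalised inversion upgrade, (E) U4 not
identically 0 -- the three items shared verbatim with HyperoctahedralRP / ModularBoosts (stmt-1981,
-1982, -0636). No idea card is realised (novel-route seat); nearest cards:
rotations-are-boosts-modular, hyperoctahedral-rp-rigidity.
Lean: `UnitSpeedTwoPoint ∧ LightConeRoundness ∧ TwoPointIsotropyToAllN ∧ ExistsScaleCovariantLimit ∧
InversionUpgradeNormalised ∧ IsingEuclidUpgradeR4NonGaussian`

## Assembly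
Pure logic (glue.lean, 12 lines, kernel-checked in the planner's Sketch.lean): take (rho, Delta, S)
from ExistsScaleCovariantLimit; UnitSpeedTwoPoint gives the two unit-cone KL representations of K =
S 2 (0,.); LightConeRoundness gives K(Rx) = K(x) for all linear isometries R; TwoPointIsotropyToAllN
gives IsRotationInvariant S, hence IsEuclideanInvariant S; InversionUpgradeNormalised gives
IsInversionCovariant Delta S, so IsMoebiusCovariant Delta S; IsingEuclidUpgradeR4NonGaussian gives
HasNontrivialU4 S; conclude CritIsing3DConformalLimit = Ising3DConformalLimit. Every hypothesis is a
crux and is used; the supports TwoPointLightConeRigidity + TwoPointKernelOfLimit discharge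
LightConeRoundness (Sketch theorem lightConeRoundness_of).

Rationale: WHY THIS LINE. Mechanism (new on this problem): a unit-speed light cone in ONE frame makes the KL
integral holomorphic in the tube {Re t > |Im w|} with the bound |K| <= K((Re t - |Im w|) n); on the
complexified LATITUDE circles (s cos psi, s sin psi, c), s^2 + c^2 = 1, the four horizontal frames
e1, e2, (e1+-e2)/sqrt2 cover every phase Re psi at every depth Im psi exactly when arcsin
sqrt((1-c^2)/(2-c^2)) > pi/8, i.e. |c| < 0.91 (exact algebra: frame e1 covers iff sin^2(Re psi) <=
(1-c^2)/(2-c^2), all Im psi), so psi -> K(latitude) is an ENTIRE 2pi-periodic function of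
exponential type <= 2Delta; Paley-Wiener for Fourier series (Boas1954 Ch. 6: a 2pi-periodic entire
function of exponential type tau is a trigonometric polynomial of degree <= tau -- one contour
shift) kills the modes |m| > 2Delta and the pi/2-rotation about e3 (in O_h) leaves m in 4Z, so K is
SO(2)-invariant on a band; the bands about e3 and e1 give O(3). Great circles do NOT work (only the
13 circles whose plane contains enough lattice directions close up), which is exactly the
obstruction HyperoctahedralRP's global step meets; latitudes evade it. The line imports classical
one-variable complex analysis (entire functions of exponential type) and the Osterwalder-Schrader /
Kallen-Lehmann structure of reflection positivity (GlimmJaffe1987 section 6.2, where forward-cone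
support is DERIVED from rotations; here the logic is inverted), no RG, no operator algebras, no
conformal maps. What it does that prior routes do not: HyperoctahedralRP assumes only nine-mirror
POSITIVITY and needs the open harmonic-analysis lemma (A); ModularBoosts assumes a light cone at
SOME speed v plus causal gluing and runs Tomita-Takesaki for all n; here the SUPPORT hypothesis at
speed exactly 1 in two frames makes the two-point rigidity a theorem, and the whole open difficulty
of clause (ii) at n = 2 is moved into one Ising-specific spectral-edge statement (US) -- physically
"the spin channel never outruns the free lattice light cone", which holds as an IDENTITY in the
solved planar model (one-fermion dispersion cosh gamma_q = 2 - cos q = free massless lattice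
dispersion at K_c, SchultzMattisLieb1964) and for every subordinated kernel f(P) of the simple
random walk. Negatives index: only SAW/percolation/Cardy items are refuted; none is touched.

RANKED CRUXES. #2 UnitSpeedTwoPoint (crux) — for every normalised, non-degenerate,
translation-invariant, scale-covariant pointwise scaling limit S of criticalCorr 3, the kernel x ->
S 2 (0,x) has Kallen-Lehmann representations in the axis frame e3 (transverse coordinates (x1,x2))
and in the face-diagonal frame (e1+e2)/sqrt2 (transverse orthonormal coordinates along (e1-e2)/sqrt2
and e3) by positive measures on (k in R^2) x (omega in R) giving zero mass to {omega < |k|}. Lattice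
reading: in the mixed spectral representation G(n,x_perp) = int lambda^|n| cos(k.x_perp) drho (ADC21
Prop. 5.3 / PerfectScreening's MixedSpectralRepresentation) the spectral edge m(k) := -log sup supp
rho(.,k) satisfies liminf_(k->0) m(k)/|k| >= 1 in both transfer directions (speed of light at least
one in lattice units). [difficulty: open-problem] (why it might fail: it is the inequality half (c
>= 1) of emergent Lorentz invariance; if the Ising spin channel had spectral weight below |k| at
small k in the axis or diagonal transfer direction (anisotropic limit) it fails; no lattice tool
presently bounds a momentum-resolved spectral edge from below at beta_c.) [GlimmJaffe1987,
SchultzMattisLieb1964, arXiv:1912.07973, arXiv:1603.03042, FrohlichEtAl1978]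
#3 TwoPointIsotropyToAllN (crux) — for every such limit S, O(3)-invariance of the two-point kernel S
2 (0, R x) = S 2 (0, x) implies IsRotationInvariant S (all n). Two attack lines: (a) the same
light-cone mechanism on n-point OS data for vertical-planar configurations (orbit functions entire
of type n Delta; D4 symmetry closes n <= 6) plus an analytic-continuation step to general
configurations; (b) the modular engine of ModularBoosts. [deps: UnitSpeedTwoPoint] [difficulty:
open-problem] (why it might fail: model-blind it is false (round S_2 with anisotropic S_4 is
compatible with scale covariance); for Ising it needs an n-point engine -- the orbit type n*Delta
exceeds 4 for n >= 8 and vertical-planar configurations are not Zariski dense.) [GlimmJaffe1987,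
OsterwalderSchrader1973, DuminilCopinICM2022]
#4 ExistsScaleCovariantLimit (crux) — there exist rho > 0 on (0,1], Delta > 0 and S with
HasPointwiseScalingLimit (criticalCorr 3) rho S, S = 0 off NonCoincident, non-degenerate two-point
function, translation invariance and scale covariance -- NO rotation clause (shared verbatim with
HyperoctahedralRP / ModularBoosts, stmt-CriticalPhenomena-1981). [difficulty: open-problem] (why it
might fail: full delta -> 0 convergence with one Delta is open on Z^3; only subsequential limits
follow from two-point bounds, and RP/GKS two-point axiomatics admit log-periodic (discretely scale
covariant) profiles.) [DuminilCopinICM2022, DuminilcopinPanis2025, arXiv:1912.07973]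
#5 InversionUpgradeNormalised (crux) — every normalised, non-degenerate, Euclidean-invariant,
scale-covariant pointwise limit of criticalCorr 3 is inversion covariant with the same Delta (shared
verbatim, stmt-CriticalPhenomena-1982). [deps: TwoPointIsotropyToAllN] [difficulty: open-problem]
(why it might fail: scale + RP + Euclid does not imply Moebius in general (free Maxwell d=3,
ScaleCovarianceNotMoebius); for Ising it fails if the limit carries a dimension-2 virial current or
lacks a local stress tensor -- excluded only numerically.) [ElshowkNakayamaRychkov2011,
DuminilCopinICM2022]
#6 IsingEuclidUpgradeR4NonGaussian (crux) — every non-degenerate pointwise scaling limit of the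
renormalised critical Ising correlators on Z^3 has U4 not identically zero on non-coincident
configurations (shared item stmt-CriticalPhenomena-0636). [difficulty: open-problem] (why it might
fail: no proof that U4 is nonzero in d = 3: the double-current intersection probability at
macroscopic separation must stay positive as delta -> 0; RP long-range models on Z^3 with alpha <
3/2 are Gaussian.) [AizenmanDuminilCopinAnnals2021, DuminilCopinICM2022]
#7 LightConeRoundness (crux) — ROUNDNESS FROM THE LIGHT CONE (Ising-specialised form of the
mechanism, the hypothesis of the deciding theorem): for every normalised, non-degenerate,
translation-invariant, scale-covariant limit S of criticalCorr 3, unit-cone Kallen-Lehmann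
representations of x -> S 2 (0,x) in the frames e3 and (e1+e2)/sqrt2 imply S 2 (0, R x) = S 2 (0, x)
for every linear isometry R. Discharged (planner Sketch.lean, theorem lightConeRoundness_of, rc 0)
by the model-blind lemma TwoPointLightConeRigidity plus the shared support TwoPointKernelOfLimit
(window 1/2 <= Delta <= 1, continuity, positivity, homogeneity, nine-mirror invariance of the limit
kernel). [deps: UnitSpeedTwoPoint] [difficulty: provable-now] (why it might fail: only through its
two supports: an anisotropic kernel meeting all hypotheses of TwoPointLightConeRigidity (pen proof
to be Lean-checked; latitude coverage and type bound verified numerically), or failure of continuity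
of the limit kernel off 0.) [Boas1954, GlimmJaffe1987, FrohlichEtAl1978]
#9 TwoPointLightConeRigidity (support) — THE MECHANISM (model-blind theorem, pen proof in section
Why this line / planner NOTES): a continuous positive kernel K on R^3 minus 0, homogeneous of degree
-2Delta with 0 < Delta < 2, invariant under the nine lattice mirror reflections, admitting
Kallen-Lehmann representations with unit light cones in the axis frame e3 and the face-diagonal
frame (e1+e2)/sqrt2, is invariant under every linear isometry of R^3. Steps: tube holomorphy + bound
|K| <= K((Re t - |Im w|)n); latitude circles with |c| < 0.91 are phase-covered by the four
horizontal frames at all depths; entire 2pi-periodic of exponential type 2Delta < 4; modes in 4Z by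
the pi/2 rotation; bands about e3 and e1 give O(3). [difficulty: provable-now] [Boas1954,
GlimmJaffe1987, BergChristensenRessel1984]
#9 TwoPointKernelOfLimit (support) — the limit two-point kernel of any non-degenerate
translation-invariant scale-covariant limit of criticalCorr 3 has 1/2 <= Delta <= 1, is continuous
off 0, positive, homogeneous of degree -2Delta, invariant and reflection positive w.r.t. the nine
lattice mirrors (shared verbatim with HyperoctahedralRP's support item; supplies the non-spectral
hypotheses of the rigidity lemma). [difficulty: provable-now] [FrohlichEtAl1978,
MessagerMiracleSoleJSP1977, DuminilcopinPanis2025]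

TWO-LAYER PLAN. UnitSpeedTwoPoint <= LatticeSpectralEdge -> EdgePassesToLimit -> UnitSpeedTwoPoint,
where LatticeSpectralEdge is the lattice statement "in the mixed spectral measure rho of
criticalTwoPoint 3 in the e3 (resp. diagonal) transfer representation, rho([exp(-(1-eps)|k|), 1] x
B(k0, r)) = 0 for |k0| small" (a momentum-resolved mass gap m(k) >= (1-o(1))|k|), and
EdgePassesToLimit is the Helly/uniqueness lemma carrying the support to the limit kernel's KL
measure (provable-now). TwoPointIsotropyToAllN <= VerticalPlanarOrbits (light-cone orbit argument, n
<= 6) -> PlanarToGeneral (real-analytic continuation in the configuration) ->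
TwoPointIsotropyToAllN. Nothing here is filed now.

KILL CRITERIA. (i) A proof that the critical Ising spectral edge in the e3 or diagonal transfer
direction lies strictly below |k| near k = 0 (spacelike weight at unit speed) refutes
UnitSpeedTwoPoint and closes the route refuted:UnitSpeedTwoPoint (it would also certify an
anisotropic or non-causal limit -- a barrier entry). (ii) An anisotropic kernel satisfying all
hypotheses of TwoPointLightConeRigidity refutes the mechanism: close refuted:LightConeRoundness
(with its support TwoPointLightConeRigidity) and file the barrier "finite-frame unit cones do not
force isotropy". (iii) Refutation of TwoPointIsotropyToAllN for Ising limits pivots the n-point step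
to the modular engine (ModularBoosts M) with the two-point milestone banked. (iv) If
HyperoctahedralRP's (A) or ModularBoosts' (L)+(M) is proved first, this route is superseded for
clause (ii) (close superseded).

NOT DECOMPOSED YET. The lattice-level spectral-edge statement and its transfer to the limit (layer 2
of UnitSpeedTwoPoint); the n-point orbit argument (layer 2 of TwoPointIsotropyToAllN); the
regularity/continuity of the limit kernel (inside the shared support TwoPointKernelOfLimit); any
quantitative version (rate of isotropisation) -- deliberately not items at open.

CHEAPEST FALSIFIER. For the mechanism: try to build an anisotropic O_h-symmetric homogeneous kernel
with unit cones in frames e3 and (e1+e2)/sqrt2 -- the planner's two families (sums over O_h of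
linear distortions |A_g x|^(-2Delta); bounded holomorphic perturbations 1 + eps sum_g
((xi.gu)^2+L^2)^(-1) on the complex quadric) FAIL (spacelike weight in some lattice frame, resp.
poles inside a covered tube), and the numerics check_latitude.py confirm the coverage inequality and
the type 2Delta; a refuter should redo the perturbative spectral-density computation for
|x|^(-2Delta)(1 + eps W) symbolically. For UnitSpeedTwoPoint: Lanczos on the 2^16 / 2^25-dimensional
transfer matrices of 4x4xinfinity and 5x5xinfinity critical tubes -- lowest Z2-odd level E1(k) - E0
against |k| at k in (2 pi/L)Z^2 (and the diagonal transfer matrix), plus the published torus spectra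
arXiv:1603.03042 (levels above the light cone): any odd level below (1-eps)|k| at small k kills the
crux. Exact check passed: d = 2, cosh gamma_q = 2 - cos q >= free cone (SchultzMattisLieb1964).

NUMBERS. Delta_sigma = 0.5181489 (bootstrap), so 2Delta = 1.036 < 4 with room; rigorous window 1/2
<= Delta <= 1 (infrared bound + Simon-Lieb; eta <= 1/2 if it exists, DuminilcopinPanis2025).
Latitude coverage: frame e1 covers phases |a| <= arcsin sqrt((1-c^2)/(2-c^2)) (45.0 deg at c=0, 27.8
deg at c=0.85, 23.6 deg at c=0.90, 21.4 deg at c=0.92); four frames at 45 deg spacing need > 22.5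
deg, i.e. |c| < 0.910. Type check: log(bound)/Im psi -> 1.036 = 2Delta (b = 4, 8, 16). Free lattice
dispersion cosh omega0(k) = 3 - cos k1 - cos k2, omega0(k) = |k| - |k|^3/24 + ..., so the lattice
edge m(k) >= omega0(k) (PerfectScreening's LSC) implies the unit cone in the limit.

DEFINITION REQUESTS. None needed at open (the KL representation, the unit-cone support and the nine
mirror normals are written inline over Mathlib: MeasureTheory.Measure (EuclideanSpace R (Fin 2) x
R), EuclideanSpace.single, Submodule.reflection). A reusable `Literature` predicate `HasUnitConeKL K
n` (KL representation of a kernel in frame n with forward-cone support) would shorten the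
statements; optional.

Novelty: Searches (2026-08-16): lit search --hybrid "spectral condition several directions implies rotation
invariance two-point function reflection positivity lattice" (15 hits: Glimm-Jaffe, Montvay-Munster,
Friedli-Velenik -- none with a finite-frame statement); lit search --hybrid "Lorentz invariance of
the two-point function follows from locality and spectral condition" (12 hits, none relevant); lit
galaxy search --star all "spectrum condition implies Lorentz invariance two-point function" (0),
"rotation invariance from reflection positivity" (0); lit galaxy search --star pdf --mode bm25
"Euclidean rotation invariance of a lattice scaling limit from transfer-matrix spectrum / light-cone
condition in several directions" (12 hits: Schroer essays, Wiese lectures, Evenbly-Vidal TNR --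
none); lit frontier CriticalPhenomena --since 2022 (60 rows; read arXiv:2404.05700,
arXiv:2601.04840, arXiv:2604.05772, arXiv:1511.05524); in-tree: all 52 theses of the sub read by
thesis line, HyperoctahedralRP / ModularBoosts / PerfectScreening / PrecisionLaplacian headers read
in full, 130 idea-card titles, cards flat-isotherm, inversion-first, commensurate-rotation-no-go,
hecke-ramanujan read.
Nearest prior art found: GlimmJaffe1987 (Thm 6.2.4 / section 19.5: forward-cone support of the KL
measure and the spectral cone are derived FROM Euclidean rotations -- the converse direction is not
stated); in tree route-CriticalPhenomena-HyperoctahedralRP (nine-mirror RP => isotropy, open lemma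
(A); identifies  [refs: 2404.05700, 2601.04840, 2604.05772, 1511.05524, GlimmJaffe1987, ElshowkNakayamaRychkov2011]

Barriers (technique_class: light-cone-support, paley-wiener-latitudes, RP): - technique_class: light-cone-support, paley-wiener-latitudes, RP
- Literature.Barriers.CriticalPhenomena.ScaleCovarianceNotMoebius: not engaged at n = 2 (the lemma
upgrades scale covariance to ROTATIONS, not to inversion, and its hypothesis -- unit-cone KL support
in two frames -- is violated by the barrier's witnesses, which are not even reflection positive);
the inversion step is the shared Ising-specific crux InversionUpgradeNormalised, typed with the
NonCoincident normalisation the barrier's narrow witness demands.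
- Literature.Barriers.CriticalPhenomena.GaussianDominationRouteNarrow: not engaged -- reflection
positivity is used only to obtain the transfer matrices / Kallen-Lehmann representations of the n.n.
Ising measure in the nine lattice directions (FrohlichEtAl1978) and, inside the shared support
TwoPointKernelOfLimit, the infrared-bound window 1/2 <= Delta <= 1 for q = 2 spins; no Gaussian
domination for general q, no Potts/random-cluster dictionary and no connectivity supply is needed,
which is what the narrowed barrier blocks. (The model-blind refutation
`not_twoPointLawMoebiusUpgrade` of the same catalogue file family is also steered around: the route
never infers a Moebius limit from a two-point law; roundness of S_2 feeds an explicit all-n crux and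
the inversion crux.)
- Literature.Barriers.CriticalPhenomena.LiouvilleRigidity: used only as context (Moebius =
similarities + inversion); no planar conformal maps are transplanted; the complex analysis is
one-vari

History (route lifecycle, newest last):
- 2026-08-25T16:13:04Z · DORMANT — reconciler: no traction for 7.8 d (last activity item-evidence-added at 2026-08-17T19:18:53Z); parked, not closed — `ledger route dormant route-CriticalPhenomen (operator:999:3059908)
- 2026-08-27T13:39:40Z · REACTIVATED — reconciler: reactivated — activity statement-claimed at 2026-08-27T11:07:20Z after parking at 2026-08-25T16:13:04Z (operator:999:3814162)
- 2026-08-29T19:32:41Z · DORMANT — census g0: costume|duplicate of route-CriticalPhenomena-HyperoctahedralRP; reader census-reader-36-g0 (operator:999:1196031)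

sub-problem: Ising3DConformalLimit · status: dormant · opened planner-plan-novel-CriticalPhenomena-Ising3DCon-3ad144fc-v2-g10-0 2026-08-16T22:43:34Z · rev 1 · ledger route-CriticalPhenomena-UnitLightCone
GENERATED by the gate from the ledger (D-0016/17). Provers cite these decls: `theorem foo : Summit.CriticalPhenomena.Ising3DConformalLimit.Theses.UnitLightCone.<Decl> := …` in Summits/CriticalPhenomena/Ising3DConformalLimit/Theorems/<Name>.lean.
-/

namespace Summit.CriticalPhenomena.Ising3DConformalLimit.Theses.UnitLightCone

open scoped BigOperators Topology Manifold Classical MeasureTheory ProbabilityTheory Matrix InnerProductSpace ComplexConjugate ContinuousMap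
open Filter Set Function TopologicalSpace MeasureTheory

attribute [summit_statement] _root_.Ising3DConformalLimit

/-- item stmt-CriticalPhenomena-17167 · crux · rank 2 · closed · proved by Summit.CriticalPhenomena.Ising3DConformalLimit.Cruxes.UnitSpeedTwoPoint.YukawaSubordination.UnitSpeedTwoPoint_of @ 4f442f4cbddd (prover) · by planner
why it might fail: it is the inequality half (c >= 1) of emergent Lorentz invariance; if the Ising spin channel had spectral weight below |k| at small k in the axis or diagonal transfer direction (anisotropic limit) it fails; no lattice tool presently bounds a momentum-resolved spectral edge from below at beta_c.
sources: GlimmJaffe1987, SchultzMattisLieb1964, arXiv:1912.07973, arXiv:1603.03042, FrohlichEtAl1978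
[crux] for every normalised, non-degenerate, translation-invariant, scale-covariant pointwise
scaling limit S of criticalCorr 3, the kernel x -> S 2 (0,x) has Kallen-Lehmann representations in
the axis frame e3 (transverse coordinates (x1,x2)) and in the face-diagonal frame (e1+e2)/sqrt2
(transverse orthonormal coordinates along (e1-e2)/sqrt2 and e3) by positive measures on (k in R^2) x
(omega in R) giving zero mass to {omega < |k|}. Lattice reading: in the mixed spectral
representation G(n,x_perp) = int lambda^|n| cos(k.x_perp) drho (ADC21 Prop. 5.3 / PerfectScreening's
MixedSpectralRepresentation) the spectral edge m(k) := -log sup supp rho(.,k) satisfies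
liminf_(k->0) m(k)/|k| >= 1 in both transfer directions (speed of light at least one in lattice
units). [difficulty: open-problem] -/
@[route_item "route-CriticalPhenomena-UnitLightCone", crux]
def UnitSpeedTwoPoint : Prop :=
  ∀ (ρ : ℝ → ℝ) (Δ : ℝ) (S : Literature.Probability.LatticeModels.CorrFamily 3), (∀ δ ∈ Set.Ioc (0:ℝ) 1, 0 < ρ δ) → Literature.Probability.LatticeModels.HasPointwiseScalingLimit (Literature.Probability.LatticeModels.criticalCorr 3) ρ S → (∀ n z, z ∉ Literature.Probability.LatticeModels.NonCoincident 3 n → S n z = 0) → Literature.Probability.LatticeModels.IsNondegenerateTwoPoint S → Literature.Probability.LatticeModels.IsTranslationInvariant S → Literature.Probability.LatticeModels.IsScaleCovariant Δ S → (∃ μ : MeasureTheory.Measure (EuclideanSpace ℝ (Fin 2) × ℝ), μ {p : EuclideanSpace ℝ (Fin 2) × ℝ | p.2 < ‖p.1‖} = 0 ∧ (∀ t a b : ℝ, t ≠ 0 → (fun x : EuclideanSpace ℝ (Fin 3) => S 2 ![0, x]) (EuclideanSpace.single 0 a + EuclideanSpace.single 1 b + EuclideanSpace.single 2 t) = ∫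 p, Real.cos (p.1 0 * a + p.1 1 * b) * Real.exp (-(p.2 * |t|)) ∂μ)) ∧ (∃ μ : MeasureTheory.Measure (EuclideanSpace ℝ (Fin 2) × ℝ), μ {p : EuclideanSpace ℝ (Fin 2) × ℝ | p.2 < ‖p.1‖} = 0 ∧ (∀ t u v : ℝ, t ≠ 0 → (fun x : EuclideanSpace ℝ (Fin 3) => S 2 ![0, x]) (EuclideanSpace.single 0 ((t + u) / Real.sqrt 2) + EuclideanSpace.single 1 ((t - u) / Real.sqrt 2) + EuclideanSpace.single 2 v) = ∫ p, Real.cos (p.1 0 * u + p.1 1 * v) * Real.exp (-(p.2 * |t|)) ∂μ))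

-- `UnitSpeedTwoPoint` holds: proved by `Summit.CriticalPhenomena.Ising3DConformalLimit.Cruxes.UnitSpeedTwoPoint.YukawaSubordination.UnitSpeedTwoPoint_of` @ 4f442f4cbddd (its module imports this route file, so no `_holds` link can be stated here).

/-- item stmt-CriticalPhenomena-17168 · crux · rank 3 · closed · proved by Summit.CriticalPhenomena.Ising3DConformalLimit.Theorems.UnitLightConeTwoPointIsotropyToAllN.TwoPointIsotropyToAllN_of @ a5d120f7a6a7 (prover) · by planner
why it might fail: model-blind it is false (round S_2 with anisotropic S_4 is compatible with scale covariance); for Ising it needs an n-point engine -- the orbit type n*Delta exceeds 4 for n >= 8 and vertical-planar configurations are not Zariski dense.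
sources: GlimmJaffe1987, OsterwalderSchrader1973, DuminilCopinICM2022
[crux] for every such limit S, O(3)-invariance of the two-point kernel S 2 (0, R x) = S 2 (0, x)
implies IsRotationInvariant S (all n). Two attack lines: (a) the same light-cone mechanism on
n-point OS data for vertical-planar configurations (orbit functions entire of type n Delta; D4
symmetry closes n <= 6) plus an analytic-continuation step to general configurations; (b) the
modular engine of ModularBoosts. [deps: UnitSpeedTwoPoint] [difficulty: open-problem] -/
@[route_item "route-CriticalPhenomena-UnitLightCone", crux]
def TwoPointIsotropyToAllN : Prop :=
  ∀ (ρ : ℝ → ℝ) (Δ : ℝ) (S : Literature.Probability.LatticeModels.CorrFamily 3), (∀ δ ∈ Set.Ioc (0:ℝ) 1, 0 < ρ δ) → Literature.Probability.LatticeModels.HasPointwiseScalingLimit (Literature.Probability.LatticeModels.criticalCorr 3) ρ S → (∀ n z, z ∉ Literature.Probability.LatticeModels.NonCoincident 3 n → S n z = 0) → Literature.Probability.LatticeModels.IsNondegenerateTwoPoint S → Literature.Probability.LatticeModels.IsTranslationInvariant S → Literature.Probability.LatticeModels.IsScaleCovariant Δ S → (∀ (R : EuclideanSpace ℝ (Fin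 3) ≃ₗᵢ[ℝ] EuclideanSpace ℝ (Fin 3)) (x : EuclideanSpace ℝ (Fin 3)), S 2 ![0, R x] = S 2 ![0, x]) → Literature.Probability.LatticeModels.IsRotationInvariant S

-- `TwoPointIsotropyToAllN` holds: proved by `Summit.CriticalPhenomena.Ising3DConformalLimit.Theorems.UnitLightConeTwoPointIsotropyToAllN.TwoPointIsotropyToAllN_of` @ a5d120f7a6a7 (its module imports this route file, so no `_holds` link can be stated here).

/-- item stmt-CriticalPhenomena-1981 · crux · rank 4 · SPLIT (gen 6) into TwoPointDoubling, ClusterSetTotallyDisconnected + glue Summit.CriticalPhenomena.Ising3DConformalLimit.Cruxes.ExistsScaleCovariantLimit.SplitGlue.hrp_crux_of_doubling_of_totallyDisconnected · direct attempts still welcome (low priority) · by planner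
why it might fail: full delta -> 0 convergence with one Delta is open on Z^3; only subsequential limits follow from two-point bounds, and RP/GKS two-point axiomatics admit log-periodic (discretely scale covariant) profiles.
sources: DuminilCopinICM2022, DuminilcopinPanis2025, arXiv:1912.07973
earlier split gen 3: TwoPointDoubling, ClusterSetTotallyDisconnected — retired -
earlier split gen 4: TwoPointDoubling, ClusterSetTotallyDisconnected — retired -
earlier split gen 5: TwoPointDoubling, ClusterSetTotallyDisconnected — retired -
[crux r4, (C), existence WITHOUT rotations] There are ρ > 0 on (0,1], Δ > 0 and S with
HasPointwiseScalingLimit (criticalCorr 3) ρ S, S = 0 off NonCoincident, IsNondegenerateTwoPoint S,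
IsTranslationInvariant S, IsScaleCovariant Δ S. Strictly weaker than CritIsing3DEuclideanLimit (item
0638: rotations included) — on this route isotropy is OUTPUT. Inputs in tree:
criticalTwoPoint_bounds_holds (c|x|⁻² ≤ G ≤ C|x|⁻¹ ⇒ subsequential limits, Δ ∈ [1/2,1]); missing:
uniqueness/full-filter convergence and continuous scale covariance (DuminilCopinICM2022 §8.4 p.29:
'widely open'). -/
@[route_item "route-CriticalPhenomena-UnitLightCone", crux]
def ExistsScaleCovariantLimit : Prop :=
  ∃ (ρ : ℝ → ℝ) (Δ : ℝ) (S : Literature.Probability.LatticeModels.CorrFamily 3), (∀ δ ∈ Set.Ioc (0:ℝ) 1, 0 < ρ δ) ∧ 0 < Δ ∧ Literature.Probability.LatticeModels.HasPointwiseScalingLimit (Literature.Probability.LatticeModels.criticalCorr 3) ρ S ∧ (∀ n z, z ∉ Literature.Probability.LatticeModels.NonCoincident 3 n → S n z = 0) ∧ Literature.Probability.LatticeModels.IsNondegenerateTwoPoint S ∧ Literature.Probability.LatticeModels.IsTranslationInvariant S ∧ Literature.Probability.LatticeModels.IsScaleCovariant Δ S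

-- parent: ExistsScaleCovariantLimit · child (gen 6)
/--     item stmt-CriticalPhenomena-6150 · crux · rank 401 · open
    parent: ExistsScaleCovariantLimit · by planner
    why it might fail: Open in print (ADC21 Rem 5.10; DCP24 Thm 1.5): every two-point axiomatic in tree (nine-mirror RP, MMS, IR/SSIR, c‖x‖⁻²≤G≤C‖x‖⁻¹, DCP24 1.2–1.3) is passed by completely monotone fat Yukawa mixtures losing doubling by unbounded factors; needs an Ising-specific exponent-free two-scale lower bound.
    sources: AizenmanDuminilCopinAnnals2021, arXiv:1912.07973, DuminilcopinPanis2025, arXiv:2404.05700, arXiv:2509.02850, DuminilCopinICM2022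
[crux] (D) ALL-SCALE DOUBLING of the axial critical two-point function on ℤ³: there is κ > 0 with
g(2n) ≥ κ·g(n) for all n ≥ 1, g(n) := ⟨σ₀σ_{n e₁}⟩⁺_{β_c(3)} (card item M3; = D1 of card
every-scale-regular-multiplicative-fekete). With MMS it gives G(z′) ≍ G(z) for ‖z′‖ ≍ ‖z‖ in all
directions; it is the one open LATTICE input of the compactness half and is filed first (the import
cone of everything below is otherwise proved: criticalTwoPoint_bounds_holds,
messager_miracleSole_holds, RP lemmas). [difficulty: open-problem] -/
@[route_item "route-CriticalPhenomena-UnitLightCone", crux]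
def TwoPointDoubling : Prop :=
  ∃ κ : ℝ, 0 < κ ∧ ∀ n : ℕ, 1 ≤ n → κ * Literature.Probability.LatticeModels.criticalTwoPoint 3 (Pi.single 0 (n : ℤ)) ≤ Literature.Probability.LatticeModels.criticalTwoPoint 3 (Pi.single 0 (2 * (n : ℤ)))

-- parent: ExistsScaleCovariantLimit · child (gen 6)
/--     item stmt-CriticalPhenomena-4659 · crux · rank 402 · open
    parent: ExistsScaleCovariantLimit · by planner
    why it might fail: Under compactness TD ⟺ singleton cluster set ⟺ full convergence: fails if Δ drifts along scales, if the zoom has a limit cycle (W_ε-type DSI witnesses pass all two-point axiomatics with two cluster points, Disproof §E), or if cluster points evade locality (Ising₃ isolation is only expected).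
    sources: Rychkov2020, arXiv:2007.14315, PolandRychkovVichi2019, arXiv:1805.04405, DuminilCopinICM2022, Literature.Probability.LatticeModels.PointwiseScalingLimitDiscreteScaleInvariance
[crux] the cluster set 𝒞 of the self-normalised family is totally disconnected in the pointwise
(product) topology of CorrFamily 3 (on 𝒞, compact under Reg, this coincides with the locally uniform
topology; pointwise is the stronger ask otherwise). INTENDED ENGINE (card items (2)–(4), the route's
point, layer 2): 𝒞 ⊆ 𝓘 := σ-correlator families of LOCAL unitary ℤ₂-symmetric 3D CFTs with exactly
one relevant odd and exactly one relevant non-identity even scalar and Δ_σ ≤ 1 (lattice side: OS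
positivity, clustering, covariance and spectrum of cluster points), and 𝓘 is totally disconnected
(CFT side, lattice-blind: 'It is expected that most local CFTs are isolated. One exception are CFTs
with exactly marginal fields of dimension Δ = d … A folk conjecture says that exactly marginal
fields in d ≥ 3 require supersymmetry' — Rychkov2020, arXiv:2007.14315 p.8, read this session; LOCAL
= 'critical points of lattice models with finite-range interactions', ibid., which is what excludes
the non-local long-range arc; an ANALYTIC isolation theorem for exact solutions of crossing — NOT a
finite-Λ positivity certificate, which only gives diam ≤ ε(Λ): refuter flag on the card, accepted).
Both halves -/
@[route_item "route-CriticalPhenomena-UnitLightCone", crux]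
def ClusterSetTotallyDisconnected : Prop :=
  IsTotallyDisconnected {S : Literature.Probability.LatticeModels.CorrFamily 3 | (∀ n x, x ∉ Literature.Probability.LatticeModels.NonCoincident 3 n → S n x = 0) ∧ ∃ u : ℕ → ℝ, (∀ k, u k ∈ Set.Ioc (0:ℝ) 1) ∧ Filter.Tendsto u Filter.atTop (nhds 0) ∧ ∀ n, TendstoLocallyUniformlyOn (fun k => Literature.Probability.LatticeModels.rescaledCorrelator (Literature.Probability.LatticeModels.criticalCorr 3) (fun δ : ℝ => (Literature.Probability.LatticeModels.criticalTwoPoint 3 (Pi.single 0 ⌊δ⁻¹⌋)) ^ (-(1/2:ℝ))) n (u k)) (S n) Filter.atTop (Literature.Probability.LatticeModels.NonCoincident 3 n)}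

/-- glue for the split of `ExistsScaleCovariantLimit`: landed theorem `Summit.CriticalPhenomena.Ising3DConformalLimit.Cruxes.ExistsScaleCovariantLimit.SplitGlue.hrp_crux_of_doubling_of_totallyDisconnected`. -/
theorem ExistsScaleCovariantLimitGlueBy_holds : TwoPointDoubling → ClusterSetTotallyDisconnected → ExistsScaleCovariantLimit := _root_.Summit.CriticalPhenomena.Ising3DConformalLimit.Cruxes.ExistsScaleCovariantLimit.SplitGlue.hrp_crux_of_doubling_of_totallyDisconnected

/-- item stmt-CriticalPhenomena-1982 · crux · rank 5 · open · by planner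
why it might fail: scale + RP + Euclid does not imply Moebius in general (free Maxwell d=3, ScaleCovarianceNotMoebius); for Ising it fails if the limit carries a dimension-2 virial current or lacks a local stress tensor -- excluded only numerically.
sources: ElshowkNakayamaRychkov2011, DuminilCopinICM2022
[crux r5, (D), inversion upgrade re-typed] Every pointwise scaling limit S of criticalCorr 3 (ρ > 0
on (0,1]) that is normalised (S = 0 off NonCoincident), non-degenerate, Euclidean invariant and
scale covariant with Δ is IsInversionCovariant Δ (hence Möbius). This is (U) of route
IsingEuclidUpgrade (item 0637, refuted AS TYPED by not_inversionUpgrade_of_euclideanLimit through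
values on the coincident locus) with the normalisation hypothesis the refutation file prescribes;
the model-blind version is false (Literature.Barriers.CriticalPhenomena.ScaleCovarianceNotMoebius;
free Maxwell d=3, ElshowkNakayamaRychkov2011), so any proof must use the Ising hypothesis (RP +
locality / absence of a dimension-2 virial current: DelamotteTissierWschebor2016 §5–6,
Nakayama2015). -/
@[route_item "route-CriticalPhenomena-UnitLightCone", crux]
def InversionUpgradeNormalised : Prop :=
  ∀ (ρ : ℝ → ℝ) (Δ : ℝ) (S : Literature.Probability.LatticeModels.CorrFamily 3), (∀ δ ∈ Set.Ioc (0:ℝ) 1, 0 < ρ δ) → Literature.Probability.LatticeModels.HasPointwiseScalingLimit (Literature.Probability.LatticeModels.criticalCorr 3) ρ S → (∀ n z, z ∉ Literature.Probability.LatticeModels.NonCoincident 3 n → S n z = 0) → Literature.Probability.LatticeModels.IsNondegenerateTwoPoint S → Literature.Probability.LatticeModels.IsEuclideanInvariant S → Literature.Probability.LatticeModels.IsScaleCovariant Δ S → Literature.Probability.LatticeModels.IsInversionCovariant Δ S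

/-- item stmt-CriticalPhenomena-0636 · crux · rank 6 · open · by planner
why it might fail: no proof that U4 is nonzero in d = 3: the double-current intersection probability at macroscopic separation must stay positive as delta -> 0; RP long-range models on Z^3 with alpha < 3/2 are Gaussian.
sources: AizenmanDuminilCopinAnnals2021, DuminilCopinICM2022
Crux r4 (non-triviality in d=3): every non-degenerate pointwise scaling limit S of the renormalised
critical Ising correlators on Z^3 has connected four-point function U4 ≢ 0 on non-coincident
configurations. Intended tool: the random-current identity U4(x,y,z,t) =
−2⟨σxσy⟩⟨σzσt⟩·P^{xy,zt}[C_{n1+n2}(x) ∩ C_{n1+n2}(z) ≠ ∅] (Aizenman 1982; ADC2021 arXiv:1912.07973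
eq. (3.11)): non-Gaussianity ⇔ the intersection probability of the two double-current clusters at
macroscopic separation does not vanish as δ → 0. Contrast: for d ≥ 4 every such limit IS Gaussian
(Literature.Probability.LatticeModels.highDim_triviality). Its negation refutes the conjunct
Ising3DConformalLimit itself. -/
@[route_item "route-CriticalPhenomena-UnitLightCone", crux]
def IsingEuclidUpgradeR4NonGaussian : Prop :=
  ∀ (ρ : ℝ → ℝ) (S : Literature.Probability.LatticeModels.CorrFamily 3), (∀ δ ∈ Set.Ioc (0:ℝ) 1, 0 < ρ δ) → Literature.Probability.LatticeModels.HasPointwiseScalingLimit (Literature.Probability.LatticeModels.criticalCorr 3) ρ S → Literature.Probability.LatticeModels.IsNondegenerateTwoPoint S → Literature.Probability.LatticeModels.HasNontrivialU4 S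

/-- item stmt-CriticalPhenomena-17169 · crux · rank 7 · closed · proved by Summit.CriticalPhenomena.Ising3DConformalLimit.Theorems.UnitLightConeLightConeRoundness.lightConeRoundness_proof @ 6cbdad3e0e44 (prover) · by planner
why it might fail: only through its two supports: an anisotropic kernel meeting all hypotheses of TwoPointLightConeRigidity (pen proof to be Lean-checked; latitude coverage and type bound verified numerically), or failure of continuity of the limit kernel off 0.
sources: Boas1954, GlimmJaffe1987, FrohlichEtAl1978
[crux] ROUNDNESS FROM THE LIGHT CONE (Ising-specialised form of the mechanism, the hypothesis of the
deciding theorem): for every normalised, non-degenerate, translation-invariant, scale-covariant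
limit S of criticalCorr 3, unit-cone Kallen-Lehmann representations of x -> S 2 (0,x) in the frames
e3 and (e1+e2)/sqrt2 imply S 2 (0, R x) = S 2 (0, x) for every linear isometry R. Discharged
(planner Sketch.lean, theorem lightConeRoundness_of, rc 0) by the model-blind lemma
TwoPointLightConeRigidity plus the shared support TwoPointKernelOfLimit (window 1/2 <= Delta <= 1,
continuity, positivity, homogeneity, nine-mirror invariance of the limit kernel). [deps:
UnitSpeedTwoPoint] [difficulty: provable-now] -/
@[route_item "route-CriticalPhenomena-UnitLightCone", crux]
def LightConeRoundness : Prop :=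
  ∀ (ρ : ℝ → ℝ) (Δ : ℝ) (S : Literature.Probability.LatticeModels.CorrFamily 3), (∀ δ ∈ Set.Ioc (0:ℝ) 1, 0 < ρ δ) → Literature.Probability.LatticeModels.HasPointwiseScalingLimit (Literature.Probability.LatticeModels.criticalCorr 3) ρ S → (∀ n z, z ∉ Literature.Probability.LatticeModels.NonCoincident 3 n → S n z = 0) → Literature.Probability.LatticeModels.IsNondegenerateTwoPoint S → Literature.Probability.LatticeModels.IsTranslationInvariant S → Literature.Probability.LatticeModels.IsScaleCovariant Δ S → (∃ μ : MeasureTheory.Measure (EuclideanSpace ℝ (Fin 2) × ℝ), μ {p : EuclideanSpace ℝ (Fin 2) × ℝ | p.2 < ‖p.1‖} = 0 ∧ (∀ t a b : ℝ, t ≠ 0 → (fun x : EuclideanSpace ℝ (Fin 3) => S 2 ![0, x]) (EuclideanSpace.single 0 a + EuclideanSpace.single 1 b + EuclideanSpace.single 2 t) = ∫ p, Real.cos (p.1 0 * a + p.1 1 * b) * Real.exp (-(p.2 * |t|)) ∂μ)) → (∃ μ : MeasureTheory.Measure (EuclideanSpace ℝ (Fin 2) × ℝ), μ {p : EuclideanSpace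 ℝ (Fin 2) × ℝ | p.2 < ‖p.1‖} = 0 ∧ (∀ t u v : ℝ, t ≠ 0 → (fun x : EuclideanSpace ℝ (Fin 3) => S 2 ![0, x]) (EuclideanSpace.single 0 ((t + u) / Real.sqrt 2) + EuclideanSpace.single 1 ((t - u) / Real.sqrt 2) + EuclideanSpace.single 2 v) = ∫ p, Real.cos (p.1 0 * u + p.1 1 * v) * Real.exp (-(p.2 * |t|)) ∂μ)) → (∀ (R : EuclideanSpace ℝ (Fin 3) ≃ₗᵢ[ℝ] EuclideanSpace ℝ (Fin 3)) (x : EuclideanSpace ℝ (Fin 3)), S 2 ![0, R x] = S 2 ![0, x])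

-- `LightConeRoundness` holds: proved by `Summit.CriticalPhenomena.Ising3DConformalLimit.Theorems.UnitLightConeLightConeRoundness.lightConeRoundness_proof` @ 6cbdad3e0e44 (its module imports this route file, so no `_holds` link can be stated here).

/-- item stmt-CriticalPhenomena-16807 · support · rank 9 · open · by planner
sources: FrohlichEtAl1978, MessagerMiracleSoleJSP1977, DuminilcopinPanis2025
[support] (shared item 1983, verbatim; PROVED in tree by
HyperoctahedralRPTwoPoint.twoPointKernelOfLimit_proof) for every non-degenerate,
translation-invariant, scale-covariant pointwise scaling limit S of criticalCorr 3 the kernel K x :=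
S 2 (0,x) has 1/2 ≤ Δ ≤ 1, ContinuousOn K {0}ᶜ, K > 0 off 0, K(c•x) = c^(−2Δ) K x, invariance and
reflection positivity in the nine lattice mirrors. This route uses the first four clauses.
[difficulty: provable-now] -/
@[route_item "route-CriticalPhenomena-UnitLightCone"]
def TwoPointKernelOfLimit : Prop :=
  ∀ (ρ : ℝ → ℝ) (Δ : ℝ) (S : Literature.Probability.LatticeModels.CorrFamily 3), (∀ δ ∈ Set.Ioc (0:ℝ) 1, 0 < ρ δ) → Literature.Probability.LatticeModels.HasPointwiseScalingLimit (Literature.Probability.LatticeModels.criticalCorr 3) ρ S → Literature.Probability.LatticeModels.IsNondegenerateTwoPoint S → Literature.Probability.LatticeModels.IsTranslationInvariant S → Literature.Probability.LatticeModels.IsScaleCovariant Δ S → (1/2 ≤ Δ ∧ Δ ≤ 1) ∧ ContinuousOn (fun x : EuclideanSpace ℝ (Fin 3) => S 2 ![0, x]) {0}ᶜ ∧ (∀ x : EuclideanSpace ℝ (Fin 3), x ≠ 0 → 0 < S 2 ![0, x]) ∧ (∀ c : ℝ, 0 < c → ∀ x : EuclideanSpace ℝ (Fin 3), S 2 ![0,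 c • x] = c ^ (-(2 * Δ)) * S 2 ![0, x]) ∧ (∀ n : EuclideanSpace ℝ (Fin 3), (∃ i j : Fin 3, i ≠ j ∧ (n = EuclideanSpace.single i 1 ∨ n = EuclideanSpace.single i 1 + EuclideanSpace.single j 1 ∨ n = EuclideanSpace.single i 1 - EuclideanSpace.single j 1)) → (∀ x : EuclideanSpace ℝ (Fin 3), S 2 ![0, ((ℝ ∙ n)ᗮ).reflection x] = S 2 ![0, x]) ∧ (∀ (m : ℕ) (p : Fin m → EuclideanSpace ℝ (Fin 3)) (c : Fin m → ℝ), (∀ a, 0 < inner ℝ (p a) n) → 0 ≤ ∑ a, ∑ b, c a * c b * S 2 ![0, p a - ((ℝ ∙ n)ᗮ).reflection (p b)]))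

/-- item stmt-CriticalPhenomena-17170 · support · rank 9 · open · by planner
sources: Boas1954, GlimmJaffe1987, BergChristensenRessel1984
[support] THE MECHANISM (model-blind theorem, pen proof in section Why this line / planner NOTES): a
continuous positive kernel K on R^3 minus 0, homogeneous of degree -2Delta with 0 < Delta < 2,
invariant under the nine lattice mirror reflections, admitting Kallen-Lehmann representations with
unit light cones in the axis frame e3 and the face-diagonal frame (e1+e2)/sqrt2, is invariant under
every linear isometry of R^3. Steps: tube holomorphy + bound |K| <= K((Re t - |Im w|)n); latitude
circles with |c| < 0.91 are phase-covered by the four horizontal frames at all depths; entire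
2pi-periodic of exponential type 2Delta < 4; modes in 4Z by the pi/2 rotation; bands about e3 and e1
give O(3). [difficulty: provable-now] -/
@[route_item "route-CriticalPhenomena-UnitLightCone"]
def TwoPointLightConeRigidity : Prop :=
  ∀ (Δ : ℝ) (K : EuclideanSpace ℝ (Fin 3) → ℝ), 0 < Δ → Δ < 2 → ContinuousOn K {0}ᶜ → (∀ x, x ≠ 0 → 0 < K x) → (∀ c : ℝ, 0 < c → ∀ x, K (c • x) = c ^ (-(2 * Δ)) * K x) → (∀ n : EuclideanSpace ℝ (Fin 3), (∃ i j : Fin 3, i ≠ j ∧ (n = EuclideanSpace.single i 1 ∨ n = EuclideanSpace.single i 1 + EuclideanSpace.single j 1 ∨ n = EuclideanSpace.single i 1 - EuclideanSpace.single j 1)) → ∀ x, K (((ℝ ∙ n)ᗮ).reflection x) = K x) → (∃ μ : MeasureTheory.Measure (EuclideanSpace ℝ (Fin 2) × ℝ), μ {p : EuclideanSpace ℝ (Fin 2) × ℝ | p.2 < ‖p.1‖} = 0 ∧ (∀ t a b : ℝ, t ≠ 0 → K (EuclideanSpace.single 0 a + EuclideanSpace.single 1 b + EuclideanSpace.single 2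 t) = ∫ p, Real.cos (p.1 0 * a + p.1 1 * b) * Real.exp (-(p.2 * |t|)) ∂μ)) → (∃ μ : MeasureTheory.Measure (EuclideanSpace ℝ (Fin 2) × ℝ), μ {p : EuclideanSpace ℝ (Fin 2) × ℝ | p.2 < ‖p.1‖} = 0 ∧ (∀ t u v : ℝ, t ≠ 0 → K (EuclideanSpace.single 0 ((t + u) / Real.sqrt 2) + EuclideanSpace.single 1 ((t - u) / Real.sqrt 2) + EuclideanSpace.single 2 v) = ∫ p, Real.cos (p.1 0 * u + p.1 1 * v) * Real.exp (-(p.2 * |t|)) ∂μ)) → ∀ (R : EuclideanSpace ℝ (Fin 3) ≃ₗᵢ[ℝ] EuclideanSpace ℝ (Fin 3)) (x : EuclideanSpace ℝ (Fin 3)), K (R x) = K x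

/-- item stmt-CriticalPhenomena-17171 · assembly · rank 1 · open · by planner
sources: GlimmJaffe1987, DuminilCopinICM2022
[assembly] ExistsScaleCovariantLimit -> UnitSpeedTwoPoint -> LightConeRoundness ->
TwoPointIsotropyToAllN -> InversionUpgradeNormalised -> IsingEuclidUpgradeR4NonGaussian ->
Ising3DConformalLimit. -/
@[route_item "route-CriticalPhenomena-UnitLightCone"]
def Assembly : Prop :=
  ExistsScaleCovariantLimit → UnitSpeedTwoPoint → LightConeRoundness → TwoPointIsotropyToAllN → InversionUpgradeNormalised → IsingEuclidUpgradeR4NonGaussian → _root_.Ising3DConformalLimit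

/-! D-0027 §2.1 — DECIDING THEOREM (planner-authored via `route open/edit --closes-file`; by planner-plan-novel-CriticalPhenomena-Ising3DCon-3ad144fc-v2- 2026-08-16T22:43:34Z):
its hypotheses are this route's items and its conclusion the sub-problem Statement (glue_lint), and it elaborates with this file. -/

@[closes "route-CriticalPhenomena-UnitLightCone"] theorem closes (hC : ExistsScaleCovariantLimit) (hUS : UnitSpeedTwoPoint)
    (hR : LightConeRoundness) (hN : TwoPointIsotropyToAllN)
    (hI : InversionUpgradeNormalised) (hU : IsingEuclidUpgradeR4NonGaussian) :
    _root_.Ising3DConformalLimit := by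
  obtain ⟨ρ, Δ, S, hρ, hΔ, hlim, hnorm, hnd, htr, hsc⟩ := hC
  obtain ⟨hax, hdg⟩ := hUS ρ Δ S hρ hlim hnorm hnd htr hsc
  have hiso2 : ∀ (R : EuclideanSpace ℝ (Fin 3) ≃ₗᵢ[ℝ] EuclideanSpace ℝ (Fin 3))
      (x : EuclideanSpace ℝ (Fin 3)), S 2 ![0, R x] = S 2 ![0, x] :=
    hR ρ Δ S hρ hlim hnorm hnd htr hsc hax hdg
  have hrot : Literature.Probability.LatticeModels.IsRotationInvariant S :=
    hN ρ Δ S hρ hlim hnorm hnd htr hsc hiso2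
  have heuc : Literature.Probability.LatticeModels.IsEuclideanInvariant S := ⟨htr, hrot⟩
  have hinvc : Literature.Probability.LatticeModels.IsInversionCovariant Δ S :=
    hI ρ Δ S hρ hlim hnorm hnd heuc hsc
  have hU4 : Literature.Probability.LatticeModels.HasNontrivialU4 S := hU ρ S hρ hlim hnd
  exact ⟨ρ, Δ, S, hρ, hΔ, hlim, hnd, ⟨heuc, hsc, hinvc⟩, hU4⟩

end Summit.CriticalPhenomena.Ising3DConformalLimit.Theses.UnitLightCone
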